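import Mathlib
import Summits.Ventures.HodgeRepro0.P8K3LatticeCDefs

/-!
# P8K3LatticeC3 (seat p8) — one kernel-evaluated integer matrix product of the family-(C) lattice certificate

See `P8K3LatticeCDefs` for the data and the paper side (proofs/p8-k3-census-latticeC.md). This module proves exactly one product identity
by `rfl` on `Matrix.mulᵣ` (kernel evaluation); the resource options are elaboration limits only, no checking-weakening option.
-/

namespace HodgeRepro0.P8K3LatticeC

set_option maxRecDepth 100000 in
set_option maxHeartbeats 4000000 in
/-- `P` is invertible over ℤ. -/
theorem P_mul_Pinv : P * Pinv = 1 := by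
  rw [← Matrix.mulᵣ_eq, ← I18_eq]; rfl

end HodgeRepro0.P8K3LatticeC
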